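import Literature.Topology.FourManifolds.GompfFramedTwistHolds
import Literature.Topology.FourManifolds.GompfFramedTwistZero
import HarnessLib

/-!
# Discharges of named facts of `GompfTheorem43.lean`

`Literature/Topology/FourManifolds/GompfTheorem43Holds.lean` — proofs-only sibling of
`GompfTheorem43.lean` (no definitions, no named facts). Each theorem below closes a named fact
`X : Prop` of that file as `X_holds : X` by composing an ACCEPTED reduction theorem of the
tree with the ACCEPTED unconditional `_holds` discharges of all of its hypotheses; nothing is
re-proved and no statement is changed. Recorded by the librarian sweep g25 (2026-08-16, pass
5c: facts dischargeable in one line from the tree's own lemmas), so that the facts census,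
`#h21_route_deps` and the cone guardrail see these facts as theorems.

Discharged here:

* `gompf2010_framedTwistZero_holds` := `gompf2010_framedTwistZero_of_framedTwist`
  `gompf2010_framedTwist_holds` (`GompfFramedTwistZero.lean`).

## References

* [GompfAGT2010] — see `lean/references.bib` and the docstring of the fact in `GompfTheorem43.lean`.
-/

namespace Literature.Topology.FourManifolds

/-- **Discharge of the named fact `gompf2010_framedTwistZero`** (`GompfTheorem43.lean`): F₀ — the
framed Theorem 2.1 for the Δ₀-moves (Gompf 2010, §4 ¶5): "Suppose the Cappell–Shaneson matrix
`A` has second column given by `[1 -1 0]ᵀ`. … — obtained as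
`gompf2010_framedTwistZero_of_framedTwist` applied to the tree's unconditional discharge
`gompf2010_framedTwist_holds` of its hypothesis (reduction in `GompfFramedTwistZero.lean`).
[cite: GompfAGT2010, §4 ¶5 (X^{τ·σ}_B = X^σ_A for B = Δ₀ᵏ A or A Δ₀ᵏ) and Thm 2.1] -/
theorem gompf2010_framedTwistZero_holds :
    gompf2010_framedTwistZero :=
  gompf2010_framedTwistZero_of_framedTwist gompf2010_framedTwist_holds

end Literature.Topology.FourManifolds
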